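import Mathlib
import HarnessLib
import Summits.HubbardSuperconductivity.HubbardSuperconductivity.Theorems.KLProgrammeKLRegimeEngineTowerLevNumericsPins

/-!
# Route `KLProgramme` — crux K3 ENGINE (stmt-HubbardSuperconductivity-20437 `KLRegimeEngineV17F2`), stub (b) v2, THE LEVELS PACKAGE (ℓ), numerics side
# «(ℓ)-NUMERICS» part 2a (cell gate-hubbard-kl, seat p4 g21): TIME-MESH-FREE BOUNDS OF THE DERIVED QUANTITIES AND OF THE ROW `B ≥ B₀`

After «(ℓ)-READOUT-CE-DIM» every numerics binder of the ∀j-assembly (`kernelNormsLevels_all_klEng[_sharp]`) is homogeneous of degree `0` in the time mesh: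
with `r := β/M` (`imagTimeWeight β M = r/2`) the law's names read `σ = s₀r²`, `τ = t₀r²`, `ψ = p₀/r²`, `Φ = φ₀/r` (…TowerLevNumericsPins §1), the base datum is
`Ab = a_b·r`, `P₀/r² ≤ Pg ≤ P₁/r²` (`Qb = Pg/8^(d−1)`), and the imports are `ι₁ ≤ i₁/r`, `ι₂ ≤ i₂/r³`, `X ≤ x₆/r⁵` (law currency of a `2p`-leg size
`∝ (M/β)^{2p−1}`).  This file is the pure real arithmetic turning these SHAPES into `r`-free one- and two-sided bounds of the assembly's derived equational
binders — `Q′` (§1 `levNum_Q'_bounds`), `Yb`, `Y` (`levNum_Yb_le`, `levNum_Y_bounds`), `A`, `A′`, `ι₃` and the re-summed size `S(λ)` (`levNum_A_bounds`,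
`levNum_A'_bounds`, `levNum_ι₃_le`, `levNum_S_le`) — and an `r`-free right-hand side for the row `B ≥ B₀` (§3 `levNum_Brow_le`:
`max 1 (max (8ΦτYb) (128eψ³τ⁴ΦκA·Yb/((1−2^{−d})ρk³))) ≤ max 1 (max (8φ₀t₀yB) (512e·p₀³t₀⁴φ₀κA·yB/(3ρk³)))`).  Part 2b (…TowerLevNumericsDoors) bounds the
seven door terms from below and the CE♯ row from above.
Pure real arithmetic; nothing about the model is asserted; nothing asserts (ℓ), any stub, K3 or superconductivity.
References: BGM 2006 §2.8 (2.83)–(2.84), (2.93)–(2.98), Lemma 2.5 (2.98) [cite: BenfattoGiulianiMastropietro2006].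
-/

noncomputable section

namespace Summit.HubbardSuperconductivity.HubbardSuperconductivity.Theorems.EngineV8

set_option linter.dupNamespace false -- summit = problem name (single-conjunct summit), D-0017

open Real

/-! ## §1 Two-sided and one-sided bounds of the derived quantities -/

section Derived

variable {r Z W κA Qb Q' Pg P₀ P₁ Ag A₀ Ab Ab' B Klam ι₂ X ι₂' X' Yb Y A A' ι₃ i₂ x₆ : ℝ} {d : ℕ}

/-- **`Q′` two-sided**: from `Qb = Pg/8^(d−1)`, `P₀/r² ≤ Pg ≤ P₁/r²`, `Q′ = Z·Qb + 1`, `0 < r ≤ 1`: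
`Z·(P₀/8^(d−1))/r² ≤ Q′`, `1 ≤ Q′`, `Q′ ≤ (Z·(P₁/8^(d−1)) + 1)/r²`. [folklore] -/
theorem levNum_Q'_bounds (hr : 0 < r) (hr1 : r ≤ 1) (hZ : 0 ≤ Z) (hP₀ : 0 ≤ P₀) (hPg₁ : P₀ / r ^ 2 ≤ Pg) (hPg₂ : Pg ≤ P₁ / r ^ 2)
    (hQb : Qb = Pg / (8 : ℝ) ^ (d - 1)) (hQ' : Q' = Z * Qb + 1) :
    Z * (P₀ / (8 : ℝ) ^ (d - 1)) / r ^ 2 ≤ Q' ∧ 1 ≤ Q' ∧ Q' ≤ (Z * (P₁ / (8 : ℝ) ^ (d - 1)) + 1) / r ^ 2 := by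
  have h8 : (0 : ℝ) < (8 : ℝ) ^ (d - 1) := by positivity
  have hr2 : 0 < r ^ 2 := by positivity
  have hQb₁ : P₀ / (8 : ℝ) ^ (d - 1) / r ^ 2 ≤ Qb := by
    rw [hQb, div_right_comm]; exact div_le_div_of_nonneg_right hPg₁ h8.le
  have hQb₂ : Qb ≤ P₁ / (8 : ℝ) ^ (d - 1) / r ^ 2 := by
    rw [hQb, div_right_comm]; exact div_le_div_of_nonneg_right hPg₂ h8.le
  have hQb0 : 0 ≤ Qb := le_trans (by positivity) hQb₁
  refine ⟨?_, ?_, ?_⟩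
  · rw [hQ', mul_div_assoc]; nlinarith [mul_le_mul_of_nonneg_left hQb₁ hZ]
  · rw [hQ']; nlinarith
  · have h1 : (1 : ℝ) ≤ 1 / r ^ 2 := by rw [le_div_iff₀ hr2]; nlinarith
    rw [hQ', add_div, mul_div_assoc]
    exact add_le_add (mul_le_mul_of_nonneg_left hQb₂ hZ) (by simpa using h1)

/-- **`Yb` from above**: with `Ab = a_b·r`, `ι₂ ≤ i₂/r³`, `X ≤ x₆/r⁵`, `QL/r² ≤ Q′ ≤ QH/r²` (`QL > 0`):
`Yb ≤ (i₂/(2QL) + W·Z³·x₆/(4QL²) + (W·27⁵ + κA)·a_b·QH/2)/r`. [folklore] -/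
theorem levNum_Yb_le {a_b QL QH : ℝ} (hr : 0 < r) (hW : 0 ≤ W) (hZ : 0 ≤ Z) (hκA : 0 ≤ κA) (hab : 0 ≤ a_b) (hQL : 0 < QL)
    (hQ'₁ : QL / r ^ 2 ≤ Q') (hQ'₂ : Q' ≤ QH / r ^ 2) (hι₂0 : 0 ≤ ι₂) (hι₂ : ι₂ ≤ i₂ / r ^ 3) (hX0 : 0 ≤ X) (hX : X ≤ x₆ / r ^ 5)
    (hAb : Ab = a_b * r) (hYb : Yb = ι₂ / (2 * Q') + W * Z ^ 3 * X / (4 * Q' ^ 2) + (W * (27 : ℝ) ^ 5 * Ab + κA * Ab) * Q' / 2) :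
    Yb ≤ (i₂ / (2 * QL) + W * Z ^ 3 * x₆ / (4 * QL ^ 2) + (W * (27 : ℝ) ^ 5 + κA) * a_b * QH / 2) / r := by
  have hQ'0 : 0 < Q' := lt_of_lt_of_le (by positivity) hQ'₁
  have hr2 : 0 < r ^ 2 := by positivity
  -- term 1
  have h1 : ι₂ / (2 * Q') ≤ i₂ / (2 * QL) / r := by
    rw [div_div, div_le_div_iff₀ (by positivity) (by positivity)]
    calc ι₂ * (2 * QL * r) = (ι₂ * r ^ 3) * (2 * (QL / r ^ 2)) := by field_simp
      _ ≤ i₂ * (2 * Q') := by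
          refine mul_le_mul ?_ (by linarith) (by positivity) ?_
          · rwa [le_div_iff₀ (by positivity)] at hι₂
          · exact le_trans (by positivity) ((le_div_iff₀ (by positivity)).1 hι₂)
  -- term 2
  have h2 : W * Z ^ 3 * X / (4 * Q' ^ 2) ≤ W * Z ^ 3 * x₆ / (4 * QL ^ 2) / r := by
    have hX' : X * r ^ 5 ≤ x₆ := (le_div_iff₀ (by positivity)).1 hX
    have hQL' : QL ≤ Q' * r ^ 2 := (div_le_iff₀ hr2).1 hQ'₁
    have hQL2 : QL ^ 2 ≤ Q' ^ 2 * r ^ 4 := by nlinarith [mul_self_le_mul_self hQL.le hQL']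
    rw [div_div, div_le_div_iff₀ (by positivity) (by positivity)]
    calc W * Z ^ 3 * X * (4 * QL ^ 2 * r) ≤ W * Z ^ 3 * X * (4 * (Q' ^ 2 * r ^ 4) * r) := by gcongr
      _ = W * Z ^ 3 * (X * r ^ 5) * (4 * Q' ^ 2) := by ring
      _ ≤ W * Z ^ 3 * x₆ * (4 * Q' ^ 2) := by gcongr
  -- term 3
  have h3 : (W * (27 : ℝ) ^ 5 * Ab + κA * Ab) * Q' / 2 ≤ (W * (27 : ℝ) ^ 5 + κA) * a_b * QH / 2 / r := by
    rw [hAb, div_div, div_le_div_iff₀ (by positivity) (by positivity)]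
    have hQ'r : Q' * r ^ 2 ≤ QH := (le_div_iff₀ hr2).1 hQ'₂
    calc (W * 27 ^ 5 * (a_b * r) + κA * (a_b * r)) * Q' * (2 * r) = (W * 27 ^ 5 + κA) * a_b * (Q' * r ^ 2) * 2 := by ring
      _ ≤ (W * 27 ^ 5 + κA) * a_b * QH * 2 := by gcongr
  rw [hYb, add_div, add_div]
  exact add_le_add (add_le_add h1 h2) h3

/-- **`Y` two-sided** (primed data `Ab′ = a_b·r/B²`, `ι₂′ ≤ i₂/(B·r³)`, `X′ ≤ x₆/(B²·r⁵)`):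
`(W·27⁵ + κA)·a_b·QL/(2B²)/r ≤ Y ≤ (i₂/(2B·QL) + W·Z³·x₆/(4B²·QL²) + (W·27⁵ + κA)·a_b·QH/(2B²))/r`. [folklore] -/
theorem levNum_Y_bounds {a_b QL QH : ℝ} (hr : 0 < r) (hW : 0 ≤ W) (hZ : 0 ≤ Z) (hκA : 0 ≤ κA) (hab : 0 ≤ a_b) (hB : 1 ≤ B) (hQL : 0 < QL)
    (hQ'₁ : QL / r ^ 2 ≤ Q') (hQ'₂ : Q' ≤ QH / r ^ 2) (hι₂0 : 0 ≤ ι₂') (hι₂ : ι₂' ≤ i₂ / (B * r ^ 3)) (hX0 : 0 ≤ X') (hX : X' ≤ x₆ / (B ^ 2 * r ^ 5))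
    (hAb' : Ab' = a_b * r / B ^ 2) (hY : Y = ι₂' / (2 * Q') + W * Z ^ 3 * X' / (4 * Q' ^ 2) + (W * (27 : ℝ) ^ 5 * Ab' + κA * Ab') * Q' / 2) :
    (W * (27 : ℝ) ^ 5 + κA) * a_b * QL / (2 * B ^ 2) / r ≤ Y ∧
      Y ≤ (i₂ / (2 * B * QL) + W * Z ^ 3 * x₆ / (4 * B ^ 2 * QL ^ 2) + (W * (27 : ℝ) ^ 5 + κA) * a_b * QH / (2 * B ^ 2)) / r := by
  have hB0 : 0 < B := by linarith
  have hup := levNum_Yb_le (a_b := a_b / B ^ 2) (QL := QL) (QH := QH) (i₂ := i₂ / B) (x₆ := x₆ / B ^ 2) hr hW hZ hκA (by positivity) hQL hQ'₁ hQ'₂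
    hι₂0 (by rw [div_div]; exact hι₂) hX0 (by rw [div_div]; exact hX) (by rw [hAb']; ring) hY
  refine ⟨?_, hup.trans (le_of_eq (by field_simp))⟩
  have hQ'0 : 0 < Q' := lt_of_lt_of_le (by positivity) hQ'₁
  have h12 : 0 ≤ ι₂' / (2 * Q') + W * Z ^ 3 * X' / (4 * Q' ^ 2) := by positivity
  have h3 : (W * (27 : ℝ) ^ 5 + κA) * a_b * QL / (2 * B ^ 2) / r ≤ (W * (27 : ℝ) ^ 5 * Ab' + κA * Ab') * Q' / 2 := by
    rw [hAb', div_div, div_le_div_iff₀ (by positivity) (by positivity)]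
    have hQ'r : QL ≤ Q' * r ^ 2 := (div_le_iff₀ (by positivity)).1 hQ'₁
    calc (W * 27 ^ 5 + κA) * a_b * QL * 2 ≤ (W * 27 ^ 5 + κA) * a_b * (Q' * r ^ 2) * 2 := by gcongr
      _ = (W * 27 ^ 5 * (a_b * r / B ^ 2) + κA * (a_b * r / B ^ 2)) * Q' * (2 * B ^ 2 * r) := by field_simp
  rw [hY]; linarith

end Derived

section DerivedA

variable {r W Z κA a_b B QL QH yL yP aP Q' Y A A' Ab' X' ι₃ ι₁ ι₂' i₁ i₂ i₃ x₆ lam : ℝ} {d : ℕ}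

/-- **`A` two-sided**: `A = 2Y(1 − 2^{−d})/(κA·Q′)`, `2 ≤ d`, `yL/r ≤ Y ≤ yP/r`, `QL/r² ≤ Q′ ≤ QH/r²` give
`(3yL/(2κA·QH))·r ≤ A ≤ (2yP/(κA·QL))·r`. [folklore] -/
theorem levNum_A_bounds (hr : 0 < r) (hd : 2 ≤ d) (hκA : 0 < κA) (hQL : 0 < QL) (hyL : 0 ≤ yL) (hY₁ : yL / r ≤ Y) (hY₂ : Y ≤ yP / r)
    (hQ'₁ : QL / r ^ 2 ≤ Q') (hQ'₂ : Q' ≤ QH / r ^ 2) (hA : A = 2 * Y * (1 - ((2 : ℝ) ^ d)⁻¹) / (κA * Q')) :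
    3 * yL / (2 * κA * QH) * r ≤ A ∧ A ≤ 2 * yP / (κA * QL) * r := by
  have hQ'0 : 0 < Q' := lt_of_lt_of_le (by positivity) hQ'₁
  have hQH : 0 < QH := by
    have : 0 < QH / r ^ 2 := hQ'0.trans_le hQ'₂
    exact (div_pos_iff_of_pos_right (by positivity)).1 this
  have hY0 : 0 ≤ Y := le_trans (by positivity) hY₁
  have hρ₁ : (3 : ℝ) / 4 ≤ 1 - ((2 : ℝ) ^ d)⁻¹ := by
    have h4 : (4 : ℝ) ≤ (2 : ℝ) ^ d := by
      calc (4 : ℝ) = 2 ^ 2 := by norm_num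
        _ ≤ 2 ^ d := pow_le_pow_right₀ (by norm_num) hd
    have : ((2 : ℝ) ^ d)⁻¹ ≤ 1 / 4 := by rw [one_div]; exact inv_anti₀ (by norm_num) h4
    linarith
  have hρ₂ : 1 - ((2 : ℝ) ^ d)⁻¹ ≤ 1 := by
    have h0 : (0 : ℝ) ≤ ((2 : ℝ) ^ d)⁻¹ := by positivity
    linarith
  have hYr : yL ≤ Y * r := (div_le_iff₀ hr).1 hY₁
  have hYr' : Y * r ≤ yP := (le_div_iff₀ hr).1 hY₂
  have hQr : QL ≤ Q' * r ^ 2 := (div_le_iff₀ (by positivity)).1 hQ'₁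
  have hQr' : Q' * r ^ 2 ≤ QH := (le_div_iff₀ (by positivity)).1 hQ'₂
  have hyP : 0 ≤ yP := le_trans (by positivity : 0 ≤ Y * r) hYr'
  constructor
  · rw [hA, le_div_iff₀ (by positivity)]
    calc 3 * yL / (2 * κA * QH) * r * (κA * Q') = 3 * yL * (Q' * r ^ 2) / (2 * QH * r) := by field_simp
      _ ≤ 3 * yL * QH / (2 * QH * r) := by gcongr
      _ = 2 * (yL / r) * (3 / 4) := by field_simp; ring
      _ ≤ 2 * Y * (1 - ((2 : ℝ) ^ d)⁻¹) := by gcongr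
  · rw [hA, div_le_iff₀ (by positivity)]
    calc 2 * Y * (1 - ((2 : ℝ) ^ d)⁻¹) ≤ 2 * Y * 1 := by gcongr
      _ = 2 * (Y * r) * QL / (QL * r) := by field_simp
      _ ≤ 2 * yP * (Q' * r ^ 2) / (QL * r) := by gcongr
      _ = 2 * yP / (κA * QL) * r * (κA * Q') := by field_simp

/-- **`A′` from above**: `A′ = (W·27⁵·Ab′ + κA·Ab′) + 2Y/Q′`, `Ab′ = a_b·r/B²`, `Y ≤ yP/r`, `QL/r² ≤ Q′` give
`0 ≤ A′ ≤ ((W·27⁵ + κA)·a_b/B² + 2yP/QL)·r`. [folklore] -/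
theorem levNum_A'_bounds (hr : 0 < r) (hW : 0 ≤ W) (hκA : 0 ≤ κA) (hab : 0 ≤ a_b) (hB : 1 ≤ B) (hQL : 0 < QL) (hY0 : 0 ≤ Y) (hY₂ : Y ≤ yP / r)
    (hQ'₁ : QL / r ^ 2 ≤ Q') (hAb' : Ab' = a_b * r / B ^ 2) (hA' : A' = (W * (27 : ℝ) ^ 5 * Ab' + κA * Ab') + 2 * Y / Q') :
    0 ≤ A' ∧ A' ≤ ((W * (27 : ℝ) ^ 5 + κA) * a_b / B ^ 2 + 2 * yP / QL) * r := by
  have hQ'0 : 0 < Q' := lt_of_lt_of_le (by positivity) hQ'₁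
  have hB0 : 0 < B := by linarith
  refine ⟨by rw [hA', hAb']; positivity, ?_⟩
  have hYr' : Y * r ≤ yP := (le_div_iff₀ hr).1 hY₂
  have hyP : 0 ≤ yP := le_trans (by positivity : 0 ≤ Y * r) hYr'
  have hQr : QL ≤ Q' * r ^ 2 := (div_le_iff₀ (by positivity)).1 hQ'₁
  have h2 : 2 * Y / Q' ≤ 2 * yP / QL * r := by
    rw [div_le_iff₀ hQ'0]
    calc 2 * Y = 2 * (Y * r) * QL / (QL * r) := by field_simp
      _ ≤ 2 * yP * (Q' * r ^ 2) / (QL * r) := by gcongr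
      _ = 2 * yP / QL * r * Q' := by field_simp
  rw [hA', hAb', add_mul]
  refine add_le_add (le_of_eq (by field_simp)) h2

/-- **`ι₃` from above**: `ι₃ = W·Z³·X′ + A′·Q′³`, `X′ ≤ x₆/(B²r⁵)`, `0 ≤ A′ ≤ aP·r`, `0 < Q′ ≤ QH/r²` give `ι₃ ≤ (W·Z³·x₆/B² + aP·QH³)/r⁵`. [folklore] -/
theorem levNum_ι₃_le (hr : 0 < r) (hW : 0 ≤ W) (hZ : 0 ≤ Z) (hB : 1 ≤ B) (hX : X' ≤ x₆ / (B ^ 2 * r ^ 5)) (hA'0 : 0 ≤ A') (hA' : A' ≤ aP * r)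
    (hQ'0 : 0 < Q') (hQ'₂ : Q' ≤ QH / r ^ 2) (hι₃ : ι₃ = W * Z ^ 3 * X' + A' * Q' ^ 3) :
    ι₃ ≤ (W * Z ^ 3 * x₆ / B ^ 2 + aP * QH ^ 3) / r ^ 5 := by
  have hB0 : 0 < B := by linarith
  have hQr' : Q' * r ^ 2 ≤ QH := (le_div_iff₀ (by positivity)).1 hQ'₂
  have hQH0 : 0 ≤ QH := le_trans (by positivity) hQr'
  have haP : 0 ≤ aP * r := hA'0.trans hA'
  have h1 : W * Z ^ 3 * X' ≤ W * Z ^ 3 * x₆ / B ^ 2 / r ^ 5 := by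
    rw [div_div]; calc W * Z ^ 3 * X' ≤ W * Z ^ 3 * (x₆ / (B ^ 2 * r ^ 5)) := by gcongr
      _ = _ := by ring
  have h2 : A' * Q' ^ 3 ≤ aP * QH ^ 3 / r ^ 5 := by
    rw [le_div_iff₀ (by positivity)]
    calc A' * Q' ^ 3 * r ^ 5 = A' * (Q' * r ^ 2) ^ 3 / r := by field_simp
      _ ≤ aP * r * QH ^ 3 / r := by gcongr
      _ = aP * QH ^ 3 := by field_simp
  rw [hι₃, add_div]; exact add_le_add h1 h2

/-- **The re-summed size `S(λ)` from above**: `S = ι₁λ + ι₂′/(2Q′) + ι₃/(4Q′²) + A′Q′/4` with `0 ≤ λ`, `ι₁ ≤ i₁/r`, `ι₂′ ≤ i₂/(B·r³)`, `ι₃ ≤ i₃/r⁵`,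
`0 ≤ A′ ≤ aP·r`, `QL/r² ≤ Q′ ≤ QH/r²` gives `S ≤ (i₁·λ + i₂/(2B·QL) + i₃/(4QL²) + aP·QH/4)/r`. [folklore] -/
theorem levNum_S_le (hr : 0 < r) (hB : 1 ≤ B) (hQL : 0 < QL) (hlam : 0 ≤ lam) (hι₁ : ι₁ ≤ i₁ / r) (hι₂0 : 0 ≤ ι₂') (hι₂ : ι₂' ≤ i₂ / (B * r ^ 3))
    (hι₃0 : 0 ≤ ι₃) (hι₃ : ι₃ ≤ i₃ / r ^ 5) (hA'0 : 0 ≤ A') (hA' : A' ≤ aP * r) (hQ'₁ : QL / r ^ 2 ≤ Q') (hQ'₂ : Q' ≤ QH / r ^ 2) :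
    ι₁ * lam + ι₂' / (2 * Q') + ι₃ / (4 * Q' ^ 2) + A' * Q' / 4 ≤ (i₁ * lam + i₂ / (2 * B * QL) + i₃ / (4 * QL ^ 2) + aP * QH / 4) / r := by
  have hQ'0 : 0 < Q' := lt_of_lt_of_le (by positivity) hQ'₁
  have hB0 : 0 < B := by linarith
  have hQr : QL ≤ Q' * r ^ 2 := (div_le_iff₀ (by positivity)).1 hQ'₁
  have hQr' : Q' * r ^ 2 ≤ QH := (le_div_iff₀ (by positivity)).1 hQ'₂
  have hi₂ : 0 ≤ i₂ := by
    have h := hι₂0.trans hι₂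
    rwa [le_div_iff₀ (by positivity), zero_mul] at h
  have hi₃ : 0 ≤ i₃ := by
    have h := hι₃0.trans hι₃
    rwa [le_div_iff₀ (by positivity), zero_mul] at h
  have h1 : ι₁ * lam ≤ i₁ * lam / r := by rw [mul_div_right_comm]; exact mul_le_mul_of_nonneg_right hι₁ hlam
  have h2 : ι₂' / (2 * Q') ≤ i₂ / (2 * B * QL) / r := by
    rw [div_div, div_le_div_iff₀ (by positivity) (by positivity)]
    have hι₂r : ι₂' * (B * r ^ 3) ≤ i₂ := (le_div_iff₀ (by positivity)).1 hι₂
    calc ι₂' * (2 * B * QL * r) ≤ ι₂' * (2 * B * (Q' * r ^ 2) * r) := by gcongr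
      _ = ι₂' * (B * r ^ 3) * (2 * Q') := by ring
      _ ≤ i₂ * (2 * Q') := by gcongr
  have h3 : ι₃ / (4 * Q' ^ 2) ≤ i₃ / (4 * QL ^ 2) / r := by
    have hQL2 : QL ^ 2 ≤ (Q' * r ^ 2) ^ 2 := pow_le_pow_left₀ hQL.le hQr 2
    rw [div_div, div_le_div_iff₀ (by positivity) (by positivity)]
    have hι₃r : ι₃ * r ^ 5 ≤ i₃ := (le_div_iff₀ (by positivity)).1 hι₃
    calc ι₃ * (4 * QL ^ 2 * r) ≤ ι₃ * (4 * (Q' * r ^ 2) ^ 2 * r) := by gcongr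
      _ = ι₃ * r ^ 5 * (4 * Q' ^ 2) := by ring
      _ ≤ i₃ * (4 * Q' ^ 2) := by gcongr
  have haP : 0 ≤ aP * r := hA'0.trans hA'
  have h4 : A' * Q' / 4 ≤ aP * QH / 4 / r := by
    rw [div_div, div_le_div_iff₀ (by positivity) (by positivity)]
    calc A' * Q' * (4 * r) = A' * (Q' * r ^ 2) * 4 / r := by field_simp
      _ ≤ aP * r * QH * 4 / r := by gcongr
      _ = aP * QH * 4 := by field_simp
  calc ι₁ * lam + ι₂' / (2 * Q') + ι₃ / (4 * Q' ^ 2) + A' * Q' / 4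
      ≤ i₁ * lam / r + i₂ / (2 * B * QL) / r + i₃ / (4 * QL ^ 2) / r + aP * QH / 4 / r := by linarith
    _ = _ := by ring

end DerivedA

/-! ## §3 The row `B ≥ B₀` has a time-mesh-free right-hand side -/

section BRow

variable {r t₀ p₀ φ₀ τ ψ Φ κA ρk Yb yB : ℝ} {d : ℕ}

/-- **`B₀` from above**: `Φ = φ₀/r`, `τ = t₀r²`, `ψ = p₀/r²`, `Yb ≤ yB/r`, `2 ≤ d`, `0 < ρk`, `0 ≤ κA` ⇒
`max 1 (max (8ΦτYb) (128·e·ψ³τ⁴ΦκA·Yb/((1 − 2^{−d})ρk³))) ≤ max 1 (max (8φ₀t₀·yB) (512·e·p₀³t₀⁴φ₀κA·yB/(3ρk³)))`. [folklore] -/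
theorem levNum_Brow_le (hr : 0 < r) (ht₀ : 0 ≤ t₀) (hp₀ : 0 ≤ p₀) (hφ₀ : 0 ≤ φ₀) (hΦ : Φ = φ₀ / r) (hτ : τ = t₀ * r ^ 2) (hψ : ψ = p₀ / r ^ 2)
    (hYb0 : 0 ≤ Yb) (hYb : Yb ≤ yB / r) (hd : 2 ≤ d) (hρk : 0 < ρk) (hκA : 0 ≤ κA) :
    max 1 (max (8 * Φ * τ * Yb) (128 * exp 1 * ψ ^ 3 * τ ^ 4 * Φ * κA * Yb / ((1 - ((2 : ℝ) ^ d)⁻¹) * ρk ^ 3))) ≤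
      max 1 (max (8 * φ₀ * t₀ * yB) (512 * exp 1 * p₀ ^ 3 * t₀ ^ 4 * φ₀ * κA * yB / (3 * ρk ^ 3))) := by
  have hYr : Yb * r ≤ yB := (le_div_iff₀ hr).1 hYb
  have hρ₁ : (3 : ℝ) / 4 ≤ 1 - ((2 : ℝ) ^ d)⁻¹ := by
    have h4 : (4 : ℝ) ≤ (2 : ℝ) ^ d := by
      calc (4 : ℝ) = 2 ^ 2 := by norm_num
        _ ≤ 2 ^ d := pow_le_pow_right₀ (by norm_num) hd
    have : ((2 : ℝ) ^ d)⁻¹ ≤ 1 / 4 := by rw [one_div]; exact inv_anti₀ (by norm_num) h4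
    linarith
  have hρ0 : 0 < 1 - ((2 : ℝ) ^ d)⁻¹ := lt_of_lt_of_le (by norm_num) hρ₁
  refine max_le_max le_rfl (max_le_max ?_ ?_)
  · calc 8 * Φ * τ * Yb = 8 * φ₀ * t₀ * (Yb * r) := by rw [hΦ, hτ]; field_simp
      _ ≤ 8 * φ₀ * t₀ * yB := by gcongr
  · rw [div_le_div_iff₀ (by positivity) (by positivity)]
    calc 128 * exp 1 * ψ ^ 3 * τ ^ 4 * Φ * κA * Yb * (3 * ρk ^ 3)
        = 128 * exp 1 * p₀ ^ 3 * t₀ ^ 4 * φ₀ * κA * (Yb * r) * (3 * ρk ^ 3) := by rw [hΦ, hτ, hψ]; field_simp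
      _ ≤ 128 * exp 1 * p₀ ^ 3 * t₀ ^ 4 * φ₀ * κA * yB * (3 * ρk ^ 3) := by gcongr
      _ = 512 * exp 1 * p₀ ^ 3 * t₀ ^ 4 * φ₀ * κA * yB * ((3 / 4) * ρk ^ 3) := by ring
      _ ≤ 512 * exp 1 * p₀ ^ 3 * t₀ ^ 4 * φ₀ * κA * yB * ((1 - ((2 : ℝ) ^ d)⁻¹) * ρk ^ 3) := by
          have hyB : 0 ≤ yB := le_trans (by positivity) hYr
          gcongr

end BRow

end Summit.HubbardSuperconductivity.HubbardSuperconductivity.Theorems.EngineV8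

end
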